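/-
Origin: expansion seat `planner-pub-hodgecm-mc-sanity-1-0`, handover #1r 2026-08-18T18:55Z md5 078093ee5e15de2fc12d3349b387e641 SUPERSEDES 2265ddda9686 (doc-only; NEW additive leaf, 378 l., new subdir HodgeCM/Model/Sanity/; imports tree HodgeCM.Automorphic.EndStateFieldCensus + HodgeCM.Proofs.LandherrDischarge only, NO rewrite) (`HOME/mc/pub-hodgecm-mc-sanity-1/lean/DegenerateCores.lean`, md5 078093ee, 378 lines);
landed by the packager successor (mc-unitary-1-g3, gen-8 kit) in gate run 32 as `HodgeCM/Model/Sanity/DegenerateCores.lean` (verbatim).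
-/
/-
HodgeCM / MODEL-CONSTRUCTION sub-cell (pub-hodgecm), node SAN — construction prover `pub-hodgecm-mc-sanity-1`
(seat planner-pub-hodgecm-mc-sanity-1-0), 2026-08-18.  Intended PKG path: `HodgeCM/Model/Sanity/DegenerateCores.lean`.
Imports PKG files BY NAME only (`EndStateFieldCensus` = prl1-g9's census of the END STATE; `Proofs.LandherrDischarge` =
the landed `ThetaModel.exists_goodCtx''`, Landherr's lemma discharged in-package); nothing restated, no new axioms, no hypotheses records, 0 proof holes.
-/
import Summits.HodgeConjecture.HodgeCM.Automorphic.EndStateFieldCensus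
import Summits.HodgeConjecture.HodgeCM.Proofs.LandherrDischarge

/-!
# Sanity: the DEGENERACY PROFILE of the seven all-characters END-STATE inputs

The E2 deliverable of the cell (MODEL-DAG §2c) is a core `C : U.AdelicThetaCore₀` — four DATA fields `emb`, `cover`,
`wm`, `Theta` — together with the SEVEN inputs `(C.thetaModelArch h w12 w34).AllCharsNonDesign` (C1 `embCover`,
C2 `innerEmb`, C3 `thetaSub`, C4 `thetaWedge`, C5 `thetaGen12All`, C6 `thetaReal34All`, C7 `occ`).  REFEREE-mc1 §0 A3
asks that every discharged input come with a non-degeneracy witness.  This file decides, KERNEL-CHECKED and for an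
ARBITRARY universe `U`, which of the seven inputs are satisfied by DEGENERATE data, i.e. which discharges carry no
evidence of content unless accompanied by a witness:

* §0–§1  Two carrier-chain lemmas: if the Weil theta model `wm V c` of a context has ZERO theta kernels
  (`θ_Φ = 0` for all `Φ`), then the END STATE's `𝒯_Φ = 0` and `ϑ_{T,χ}(Φ) = 0`, `ϑ_{T',χ}(Φ) = 0` (definitional
  unfolding through `ofRegCarrier ∘ rtc ∘ lmd` + `integral_zero`).  The DEGENERATE Weil theta model
  `degenerateWeilThetaModel` (`Mp = SX = Unit`, `Θ = 0`; prl1-g10 `JunctionE.lean`, verbatim) has zero kernels.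
* §2  ZERO KERNELS ⇒ C7 `Open_occ` HOLDS (premise `𝒯_Φ v ≠ 0` never met), C6 `Open_thetaReal34All` HOLDS
  (`0 ∈` every closed span), and C5 `Open_thetaGen12All` ⟺ `emb Γ (ω₁ ∪ ω₂) = 0` for all theta one-forms
  `ω₁ ∈ Θ₀`, `ω₂ ∈ Θ₁` of every good context (the target closed span is `{0}`).
* §3  EMPTY THETA SETS (`Theta = ∅`) ⇒ C3 `Open_thetaSub` and C5 HOLD vacuously, and C4 `Open_thetaWedge` ⟺ no good
  context exists; since good contexts DO exist for every END STATE (`ThetaModel.exists_goodCtx''` + the two design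
  theorems; Landherr's lemma is proved in-package), C4 FAILS: **C4 is never degenerate-satisfiable.**
* §4  ZERO EMBEDDING (`emb = 0`) ⇒ C1 `Fact_embCover` HOLDS, and C2 `Fact_innerEmb` ⟺ every Petersson trace
  `tr_ℂ(η ∪ η̄')`, `η, η' ∈ F²H²(P_Γ)`, vanishes in EVERY context (so C2 fails as soon as one period surface of `U`
  carries a `(2,0)`-class of nonzero Petersson norm — for `toyUniverse₃` see `Sanity/Toy3Cores.lean`).
* §5  The OFF-REGIME corner made explicit: if `V.Hm` is not anisotropic the core-side model group is trivial, so
  `[G_U]` is ONE point (`Subsingleton`) — the target of `emb Γ` is then at most one-dimensional while C1/C2 are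
  UNGUARDED (MODEL-SCOPE A.3 row h09a/b "CORNER"; carver ruling J-G0-1).

PROFILE (any `U`; ✓ = kernel theorem here, ✗ = kernel refutation here, · = not decided by degenerate data):

| data                         | C1 | C2 | C3 | C4 | C5 | C6 | C7 |
|------------------------------|----|----|----|----|----|----|----|
| `wm :=` degenerate (θ = 0)   | ·  | ·  | ·  | ·  | ⟺ emb kills Θ₀∧Θ₁ | ✓ | ✓ |
| `Theta := ∅`                 | ·  | ·  | ✓  | ✗  | ✓  | ·  | ·  |
| `emb := 0`                   | ✓  | ⟺ all Petersson traces vanish | · | · | (✓ with θ = 0) | · | · |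

Consequence for the referees (A3): discharges of C1, C3, C5, C6, C7 are uninformative without a witness; C2 and C4
cannot be met by degenerate data; given honest `emb`/`Theta` (C2, C4), C5 is the input that detects a degenerate `wm`
(C6 and C7 never do — C7's premise and C6's conclusion are both insensitive to `θ = 0`).
-/

set_option autoImplicit false

noncomputable section

open HodgeCM HodgeCM.Universe MeasureTheory
open scoped InnerProductSpace
open Literature.AlgebraicGeometry.Motives (HodgeStructure)
open Literature.AlgebraicGeometry.Motives.HodgeStructure (conj)

attribute [-instance] Quotient.instMeasurableSpace

namespace HodgeCM

/-! ## §0 Two generic vanishing lemmas for kernel-model carriers (zero theta kernel) -/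

namespace KernelCoreCarrier

variable {G : Type} [Group G] [TopologicalSpace G]
variable {Γ : Subgroup G} [MeasurableSpace (G ⧸ Γ)] [BorelSpace (G ⧸ Γ)] [CompactSpace (G ⧸ Γ)]
variable {μQ : Measure (G ⧸ Γ)} [IsFiniteMeasure μQ]
variable {XU : Type} [TopologicalSpace XU] [CompactSpace XU]
variable {HG : Type} [NormedAddCommGroup HG] [InnerProductSpace ℂ HG] [CompleteSpace HG]
variable {SK SigIdxG : Type} [TopologicalSpace SK]
variable (K : KernelCoreCarrier G Γ μQ XU HG SK SigIdxG)

/-- The kernel operator of the zero kernel vanishes: `θ_Φ = 0 ⇒ 𝒯_Φ v = 0` (`TΦc_apply` + `integral_zero`). -/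
theorem TΦc_apply_eq_zero_of_θ_eq_zero (Φ : SK) (hθ : K.θ Φ = 0) (v : Lp ℂ 2 μQ) :
    K.toRegCoreCarrier.TΦc Φ v = 0 := by
  ext ξ
  rw [KernelCoreCarrier.TΦc_apply, hθ]
  simp

end KernelCoreCarrier

namespace KernelTorusCarrier

variable {G : Type} [Group G] [TopologicalSpace G]
variable {Γ : Subgroup G} [MeasurableSpace (G ⧸ Γ)]
variable {μQ : Measure (G ⧸ Γ)}
variable {XU : Type} [TopologicalSpace XU] [CompactSpace XU]
variable {HG : Type} [NormedAddCommGroup HG] [InnerProductSpace ℂ HG] [CompleteSpace HG]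
variable {SK SigIdxG : Type} [TopologicalSpace SK]
variable {K : KernelCoreCarrier G Γ μQ XU HG SK SigIdxG}
variable {T : Type} [Group T] [TopologicalSpace T] [MeasurableSpace T] (D : KernelTorusCarrier K T)

/-- The torus period of the zero kernel vanishes: `θ_Φ = 0 ⇒ ϑ_{T,χ}(Φ) = 0` (`ϑc_def` + `integral_zero`). -/
theorem ϑc_eq_zero_of_θ_eq_zero (x : D.X) (Φ : SK) (hθ : K.θ Φ = 0) : D.ϑc x Φ = 0 := by
  rw [KernelTorusCarrier.ϑc_def, hθ, KernelOp.period_def]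
  have h0 : ∀ q, KernelOp.sliceQ (0 : C(XU × (G ⧸ Γ), ℂ)) q = 0 := fun q => by ext x; rfl
  simp [h0]

end KernelTorusCarrier

/-! ## §1 The degenerate Weil theta model and the carrier chain of the END STATE -/

/-- **The DEGENERATE Weil theta model** over any pair of quotients (`Mp = SX = Unit`, `Θ = 0`, `s = 1`,
`SK = univ`) — VERBATIM prl1-g10's `JunctionE.degenerateWeilThetaModel` (J1 off-regime: what a producer supplies for
`wm V c` outside PerL's regime).  Here it is the universal degenerate test datum. -/
def degenerateWeilThetaModel (GU : Type) [Group GU] [TopologicalSpace GU] (ΓU : Subgroup GU)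
    (G : Type) [Group G] [TopologicalSpace G] (Γ : Subgroup G) : WeilThetaModel GU ΓU G Γ where
  W := { Mp := Unit, SX := Unit, act := fun _ x => x, rat := Set.univ, theta := fun _ _ => 0 }
  act_one _ := rfl
  theta_act _ _ _ := rfl
  actionContinuous := continuous_snd
  thetaContinuousInvariant := ⟨fun _ => continuous_const, fun _ _ _ _ => rfl⟩
  dist_cont := continuous_const
  s := 1
  s_cont := continuous_const
  s_rat _ _ _ _ := Set.mem_univ _
  SK := Set.univ
  SK_stable _ _ _ := Set.mem_univ _

/-- The degenerate model has ZERO theta kernels `θ_Φ ∈ C([G_U] × [U(W)], ℂ)`. -/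
theorem degenerateWeilThetaModel_θ (GU : Type) [Group GU] [TopologicalSpace GU] [IsTopologicalGroup GU]
    (ΓU : Subgroup GU) (G : Type) [Group G] [TopologicalSpace G] [IsTopologicalGroup G] (Γ : Subgroup G)
    (Φ : (degenerateWeilThetaModel GU ΓU G Γ).SK) :
    (degenerateWeilThetaModel GU ΓU G Γ).θ Φ = 0 := by
  ext ⟨qx, qy⟩
  induction qx using QuotientGroup.induction_on with
  | H x =>
    induction qy using QuotientGroup.induction_on with
    | H y => rfl

namespace Universe.AdelicThetaCore

variable {U : Universe} {hP : PrintFact_unitaryCompact} (C : U.AdelicThetaCore hP) (h : Bool)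
variable (d12 d34 : ∀ {L : CMField}, SeesawCtx L → SideData L)

/-- The kernel-model theta data the END STATE `C.thetaModel h d12 d34` is built from. -/
abbrev kmd : U.KernelModelThetaData :=
  ((C.toCore h).lmd ((C.toCore h).side12 d12) ((C.toCore h).side34 d34)).toWeilModelThetaData.toKernelModelThetaData

section CarrierChain

variable {L : CMField} {ι₁ : L →+* ℂ} (V : HermSpace3 L ι₁) (c : SeesawCtx L)

/-- Definitional: the theta kernels of the END STATE are those of the core's Weil theta model `C.wm V c`. -/
theorem kmd_kcore_θ : ((C.kmd h d12 d34).kcore V c).θ = (C.wm V c).θ := rfl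

/-- Definitional: the index set `𝒮^κ` of the END STATE is that of `C.wm V c`. -/
theorem thetaModel_SK : (C.thetaModel h d12 d34).SK V c = ↥(C.wm V c).SK := rfl

/-- Definitional unfolding of `𝒯_Φ` of the END STATE through the carrier chain. -/
theorem thetaModel_TΦ_apply (Φ : (C.thetaModel h d12 d34).SK V c) (v : (C.thetaModel h d12 d34).H V c) :
    ((C.thetaModel h d12 d34).core V c).TΦ Φ v =
      ((C.kmd h d12 d34).kcore V c).inclCG ((((C.kmd h d12 d34).kcore V c).toRegCoreCarrier.TΦc Φ) v) := rfl

/-- Definitional unfolding of `ϑ_{T,χ}(Φ)` (side 12) of the END STATE through the carrier chain. -/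
theorem thetaModel_ϑ12 (χ : ((C.thetaModel h d12 d34).t12 V c).X) (Φ : (C.thetaModel h d12 d34).SK V c) :
    ((C.thetaModel h d12 d34).t12 V c).ϑ χ Φ =
      ((C.kmd h d12 d34).kcore V c).inclCG (((C.kmd h d12 d34).kt12 V c).ϑc χ Φ) := rfl

/-- Definitional unfolding of `ϑ_{T',χ}(Φ)` (side 34). -/
theorem thetaModel_ϑ34 (χ : ((C.thetaModel h d12 d34).t34 V c).X) (Φ : (C.thetaModel h d12 d34).SK V c) :
    ((C.thetaModel h d12 d34).t34 V c).ϑ χ Φ =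
      ((C.kmd h d12 d34).kcore V c).inclCG (((C.kmd h d12 d34).kt34 V c).ϑc χ Φ) := rfl

/-- **Zero theta kernels ⇒ `𝒯_Φ = 0`.** -/
theorem thetaModel_TΦ_eq_zero (hθ : ∀ Φ : (C.wm V c).SK, (C.wm V c).θ Φ = 0)
    (Φ : (C.thetaModel h d12 d34).SK V c) (v : (C.thetaModel h d12 d34).H V c) :
    ((C.thetaModel h d12 d34).core V c).TΦ Φ v = 0 := by
  rw [thetaModel_TΦ_apply,
    KernelCoreCarrier.TΦc_apply_eq_zero_of_θ_eq_zero ((C.kmd h d12 d34).kcore V c) Φ (hθ Φ) v]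
  exact map_zero _

/-- **Zero theta kernels ⇒ `ϑ_{T,χ}(Φ) = 0` (side 12).** -/
theorem thetaModel_ϑ12_eq_zero (hθ : ∀ Φ : (C.wm V c).SK, (C.wm V c).θ Φ = 0)
    (χ : ((C.thetaModel h d12 d34).t12 V c).X) (Φ : (C.thetaModel h d12 d34).SK V c) :
    ((C.thetaModel h d12 d34).t12 V c).ϑ χ Φ = 0 := by
  rw [thetaModel_ϑ12, ((C.kmd h d12 d34).kt12 V c).ϑc_eq_zero_of_θ_eq_zero χ Φ (hθ Φ)]
  exact map_zero _

/-- **Zero theta kernels ⇒ `ϑ_{T',χ}(Φ) = 0` (side 34).** -/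
theorem thetaModel_ϑ34_eq_zero (hθ : ∀ Φ : (C.wm V c).SK, (C.wm V c).θ Φ = 0)
    (χ : ((C.thetaModel h d12 d34).t34 V c).X) (Φ : (C.thetaModel h d12 d34).SK V c) :
    ((C.thetaModel h d12 d34).t34 V c).ϑ χ Φ = 0 := by
  rw [thetaModel_ϑ34, ((C.kmd h d12 d34).kt34 V c).ϑc_eq_zero_of_θ_eq_zero χ Φ (hθ Φ)]
  exact map_zero _

end CarrierChain

/-! ## §2 ZERO KERNELS: C7 and C6 hold outright; C5 reduces to "emb kills the theta wedges" -/

section ZeroKernels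

/-- "the Weil theta models of `C` have zero kernels in every context" -/
def ZeroKernels : Prop :=
  ∀ {L : CMField} {ι₁ : L →+* ℂ} (V : HermSpace3 L ι₁) (c : SeesawCtx L) (Φ : (C.wm V c).SK), (C.wm V c).θ Φ = 0

variable {C}

/-- **C7 `Open_occ` HOLDS for zero kernels** — its premise `∃ v ∈ σ̂, 𝒯_Φ v ≠ 0` is never met. -/
theorem open_occ_of_zeroKernels (hθ : C.ZeroKernels) : (C.thetaModel h d12 d34).Open_occ := by
  intro L ι₁ V c _
  refine ⟨fun Φ i hv => ?_, fun Φ i hv => ?_⟩ <;>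
  · obtain ⟨v, -, hv⟩ := hv
    exact (hv (C.thetaModel_TΦ_eq_zero h d12 d34 V c (hθ V c) Φ v)).elim

/-- **C6 `Open_thetaReal34All` HOLDS for zero kernels** — `ϑ_{T',χ}(Φ) = 0` lies in every closed span. -/
theorem open_thetaReal34All_of_zeroKernels (hθ : C.ZeroKernels) : (C.thetaModel h d12 d34).Open_thetaReal34All := by
  intro L ι₁ V c _ χ Φ
  rw [C.thetaModel_ϑ34_eq_zero h d12 d34 V c (hθ V c) χ Φ]
  exact Submodule.zero_mem _

/-- For zero kernels the closed span of the generators `ϑ_{T,χ}(Φ)` of side 12 is `{0}`. -/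
theorem span_ϑ12_eq_bot_of_zeroKernels (hθ : C.ZeroKernels) {L : CMField} {ι₁ : L →+* ℂ} (V : HermSpace3 L ι₁)
    (c : SeesawCtx L) :
    (Submodule.span ℂ {u : (C.thetaModel h d12 d34).HG L ι₁ V |
        ∃ (χ : ((C.thetaModel h d12 d34).t12 V c).X) (Φ : (C.thetaModel h d12 d34).SK V c),
          u = ((C.thetaModel h d12 d34).t12 V c).ϑ χ Φ}).topologicalClosure = ⊥ := by
  have hle : Submodule.span ℂ {u : (C.thetaModel h d12 d34).HG L ι₁ V |
      ∃ (χ : ((C.thetaModel h d12 d34).t12 V c).X) (Φ : (C.thetaModel h d12 d34).SK V c),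
        u = ((C.thetaModel h d12 d34).t12 V c).ϑ χ Φ} ≤ ⊥ := by
    refine Submodule.span_le.mpr ?_
    rintro u ⟨χ, Φ, rfl⟩
    rw [SetLike.mem_coe, Submodule.mem_bot]
    exact C.thetaModel_ϑ12_eq_zero h d12 d34 V c (hθ V c) χ Φ
  refine le_bot_iff.mp (Submodule.topologicalClosure_minimal _ hle ?_)
  rw [Submodule.bot_coe]
  exact isClosed_singleton

/-- **C5 `Open_thetaGen12All` for zero kernels ⟺ `emb` kills every theta wedge `ω₁ ∪ ω₂`, `ω₁ ∈ Θ₀`, `ω₂ ∈ Θ₁`,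
of every good context** (the target closed span being `{0}`). -/
theorem open_thetaGen12All_iff_of_zeroKernels (hθ : C.ZeroKernels) :
    (C.thetaModel h d12 d34).Open_thetaGen12All ↔
      ∀ {L : CMField} {ι₁ : L →+* ℂ} (V : HermSpace3 L ι₁) (c : SeesawCtx L), SignRecipe.GoodCtx h ι₁ c →
        ∀ (Γ : Level V) (ω₁ ω₂ : U.CohC (U.pms L ι₁ V Γ) 1), ω₁ ∈ C.Theta V c 0 Γ → ω₂ ∈ C.Theta V c 1 Γ →
          C.emb Γ (U.cup2C (U.pms L ι₁ V Γ) 1 ω₁ ω₂) = 0 := by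
  constructor
  · intro H L ι₁ V c hc Γ ω₁ ω₂ h₁ h₂
    have hmem := H V c ((C.thetaModel_goodCtx_iff h d12 d34 ι₁ c).mpr hc) Γ ω₁ ω₂ h₁ h₂
    rw [span_ϑ12_eq_bot_of_zeroKernels h d12 d34 hθ V c, Submodule.mem_bot] at hmem
    exact hmem
  · intro H L ι₁ V c hc Γ ω₁ ω₂ h₁ h₂
    have h0 : (C.thetaModel h d12 d34).Λ Γ ω₁ ω₂ = 0 :=
      H V c ((C.thetaModel_goodCtx_iff h d12 d34 ι₁ c).mp hc) Γ ω₁ ω₂ h₁ h₂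
    rw [h0]
    exact Submodule.zero_mem _

end ZeroKernels

/-- The core with the given `emb`, `cover`, `Theta` and DEGENERATE Weil theta models in every context. -/
def withDegenerateWM : U.AdelicThetaCore hP :=
  ⟨C.emb, C.cover, fun _ _ => degenerateWeilThetaModel _ _ _ _, C.Theta⟩

/-- (Ported verbatim from the HodgeCMPerL package; no docstring in the source.) -/
@[simp] theorem withDegenerateWM_emb {L : CMField} {ι₁ : L →+* ℂ} {V : HermSpace3 L ι₁} (Γ : Level V) :
    C.withDegenerateWM.emb Γ = C.emb Γ := rfl

/-- (Ported verbatim from the HodgeCMPerL package; no docstring in the source.) -/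
@[simp] theorem withDegenerateWM_cover {L : CMField} {ι₁ : L →+* ℂ} {V : HermSpace3 L ι₁} (Γ Γ' : Level V)
    (hle : Γ'.Γ ≤ Γ.Γ) : C.withDegenerateWM.cover Γ Γ' hle = C.cover Γ Γ' hle := rfl

/-- (Ported verbatim from the HodgeCMPerL package; no docstring in the source.) -/
@[simp] theorem withDegenerateWM_Theta {L : CMField} {ι₁ : L →+* ℂ} (V : HermSpace3 L ι₁) (c : SeesawCtx L)
    (i : Fin 4) (Γ : Level V) : C.withDegenerateWM.Theta V c i Γ = C.Theta V c i Γ := rfl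

/-- (Ported verbatim from the HodgeCMPerL package; no docstring in the source.) -/
@[simp] theorem withDegenerateWM_wm {L : CMField} {ι₁ : L →+* ℂ} (V : HermSpace3 L ι₁) (c : SeesawCtx L) :
    C.withDegenerateWM.wm V c = degenerateWeilThetaModel _ _ _ _ := rfl

/-- `C.withDegenerateWM` has zero kernels. -/
theorem withDegenerateWM_zeroKernels : C.withDegenerateWM.ZeroKernels :=
  fun _ _ Φ => degenerateWeilThetaModel_θ _ _ _ _ Φ

/-! ## §3 EMPTY THETA SETS: C3 and C5 hold vacuously; C4 fails (good contexts exist) -/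

section EmptyTheta

/-- "every theta set of `C` is empty" -/
def EmptyTheta : Prop :=
  ∀ {L : CMField} {ι₁ : L →+* ℂ} (V : HermSpace3 L ι₁) (c : SeesawCtx L) (i : Fin 4) (Γ : Level V),
    C.Theta V c i Γ = ∅

variable {C}

/-- **C3 `Open_thetaSub` HOLDS for empty theta sets** (`∅ ⊆ U_iso`). -/
theorem open_thetaSub_of_emptyTheta (hΘ : C.EmptyTheta) : (C.thetaModel h d12 d34).Open_thetaSub :=
  (C.thetaModel_thetaSub_iff h d12 d34).mpr fun V c _ i Γ => by
    rw [hΘ V c i Γ]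
    exact Set.empty_subset _

/-- **C5 `Open_thetaGen12All` HOLDS for empty theta sets** (no `ω₁ ∈ Θ₀`). -/
theorem open_thetaGen12All_of_emptyTheta (hΘ : C.EmptyTheta) : (C.thetaModel h d12 d34).Open_thetaGen12All := by
  intro L ι₁ V c _ Γ ω₁ ω₂ h₁ _
  rw [C.thetaModel_Theta h d12 d34, hΘ V c 0 Γ] at h₁
  exact h₁.elim

/-- **C4 `Open_thetaWedge` for empty theta sets ⟺ NO good context exists anywhere.** -/
theorem open_thetaWedge_iff_of_emptyTheta (hΘ : C.EmptyTheta) :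
    (C.thetaModel h d12 d34).Open_thetaWedge ↔
      ∀ {L : CMField} {ι₁ : L →+* ℂ} (_ : HermSpace3 L ι₁) (c : SeesawCtx L), ¬ SignRecipe.GoodCtx h ι₁ c := by
  rw [C.thetaModel_thetaWedge_iff h d12 d34]
  constructor
  · intro H L ι₁ V c hc
    obtain ⟨Γ, ω₁, h₁, -⟩ := H V c hc
    rw [hΘ V c 0 Γ] at h₁
    exact h₁
  · intro H L ι₁ V c hc
    exact (H V c hc).elim

/-- **Good contexts EXIST for every END STATE** (any universe, any core, any side data): the landed
`ThetaModel.exists_goodCtx''` (face datum of `ℚ(ζ₇)`, Landherr's hermitian space, the constructed seesaw datum,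
Landherr's lemma proved in-package) applied to the END STATE, whose two design constraints are theorems
(`design_kappaConj`, `design_frameSignConj`); model-free by `thetaModel_goodCtx_iff`. -/
theorem exists_signRecipe_goodCtx (C : U.AdelicThetaCore hP) (d12 d34 : ∀ {L : CMField}, SeesawCtx L → SideData L) :
    ∃ (F : CMField) (ι₁ : F →+* ℂ) (_ : HermSpace3 F ι₁) (c : SeesawCtx F), SignRecipe.GoodCtx h ι₁ c := by
  obtain ⟨F, ι₁, V, c, hc⟩ := (C.thetaModel h d12 d34).exists_goodCtx'' (C.design_kappaConj h d12 d34)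
    (C.design_frameSignConj h d12 d34)
  exact ⟨F, ι₁, V, c, (C.thetaModel_goodCtx_iff h d12 d34 ι₁ c).mp hc⟩

/-- **C4 `Open_thetaWedge` FAILS for empty theta sets** — C4 is never degenerate-satisfiable. -/
theorem not_open_thetaWedge_of_emptyTheta (hΘ : C.EmptyTheta) : ¬ (C.thetaModel h d12 d34).Open_thetaWedge := by
  rw [open_thetaWedge_iff_of_emptyTheta h d12 d34 hΘ]
  intro H
  obtain ⟨F, ι₁, V, c, hc⟩ := exists_signRecipe_goodCtx h C d12 d34
  exact H V c hc

end EmptyTheta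

/-! ## §4 ZERO EMBEDDING: C1 holds; C2 reduces to "all Petersson traces vanish" -/

section ZeroEmb

/-- "the embedding `emb Γ` of `C` is zero at every level of every context" -/
def ZeroEmb : Prop :=
  ∀ {L : CMField} {ι₁ : L →+* ℂ} {V : HermSpace3 L ι₁} (Γ : Level V), C.emb Γ = 0

variable {C}

/-- **C1 `Fact_embCover` HOLDS for the zero embedding** (whatever `cover` is). -/
theorem fact_embCover_of_zeroEmb (he : C.ZeroEmb) : (C.thetaModel h d12 d34).Fact_embCover :=
  (C.thetaModel_embCover_iff h d12 d34).mpr fun Γ Γ' _ η => by rw [he Γ, he Γ']; rfl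

/-- **C2 `Fact_innerEmb` for the zero embedding ⟺ every Petersson trace `tr_ℂ(η ∪ η̄')` (`η, η' ∈ F²H²(P_Γ)`)
vanishes, in EVERY context** (unguarded: all `L`, `ι₁`, `V`, `Γ`). -/
theorem fact_innerEmb_iff_of_zeroEmb (he : C.ZeroEmb) :
    (C.thetaModel h d12 d34).Fact_innerEmb ↔
      ∀ {L : CMField} {ι₁ : L →+* ℂ} {V : HermSpace3 L ι₁} (Γ : Level V) (η η' : U.CohC (U.pms L ι₁ V Γ) 2),
        η ∈ (U.hodge (U.pms L ι₁ V Γ) 2).F 2 → η' ∈ (U.hodge (U.pms L ι₁ V Γ) 2).F 2 →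
          U.trC (U.pms L ι₁ V Γ) 4 (U.cup2C (U.pms L ι₁ V Γ) 2 η (conj η')) = 0 := by
  rw [C.thetaModel_innerEmb_iff h d12 d34]
  constructor
  · intro H L ι₁ V Γ η η' hη hη'
    obtain ⟨a, ha, H⟩ := H Γ
    have h0 := H η η' hη hη'
    rw [he Γ, LinearMap.zero_apply, inner_zero_left] at h0
    exact (mul_eq_zero.mp h0.symm).resolve_left ha
  · intro H L ι₁ V Γ
    refine ⟨1, one_ne_zero, fun η η' hη hη' => ?_⟩
    rw [he Γ, LinearMap.zero_apply, inner_zero_left, H Γ η η' hη hη', mul_zero]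

end ZeroEmb

/-! ## §5 The OFF-REGIME corner, explicitly -/

/-- **Off the anisotropic regime the core-side model group is trivial**, hence `[G_U] = G_U(L⁺)\G_U(𝔸)` (as
modelled: `regimeSubgroup`) is ONE point — while C1/C2 quantify over such contexts too (MODEL-SCOPE A.3 h09a/b
CORNER; carver ruling J-G0-1).  PKG `Adelic.eq_one_of_not_isAnisotropic`, by name. -/
theorem subsingleton_quotient_of_not_isAnisotropic {L : CMField} {ι₁ : L →+* ℂ} (V : HermSpace3 L ι₁)
    (hV : ¬ IsAnisotropic L V.Hm) :
    Subsingleton ((V.latticeModel hP).toQuotientModel.G ⧸ (V.latticeModel hP).toQuotientModel.Γ) := by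
  refine ⟨fun a b => ?_⟩
  induction a using QuotientGroup.induction_on with
  | H x =>
    induction b using QuotientGroup.induction_on with
    | H y => rw [Adelic.eq_one_of_not_isAnisotropic hV x, Adelic.eq_one_of_not_isAnisotropic hV y]

end Universe.AdelicThetaCore

end HodgeCM

end
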